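import Mathlib

/-!
# The minimal mechanism behind the failure of the vdBHK (2006) mixed-graph conjecture — a
kernel-checked six-vertex witness with every weight `7/8` (blind cell PercRepro2, lead)

van den Berg–Häggström–Kahn, *Some conditional correlation inequalities for percolation and related
processes*, Random Structures & Algorithms 29 (2006), Theorem 3.4 (directed graphs): for independent
arcs, `s ≠ t`, `C_v` the set of open arcs lying on open oriented paths from `v`, `V(F)` the vertices
incident with `F`, `Q := {V(C_s) ∩ V(C_t) = ∅}`, and `f, g` functions of `(C_s, C_t)` with `f`
increasing in `C_s` and decreasing in `C_t`, `g` decreasing in `C_s` and increasing in `C_t`, one has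
`E[fg | Q] ≥ E[f | Q]·E[g | Q]`.  The paper conjectures (p. 18) that the theorem «remains true without
the restriction» that all edges are directed (MIXED graphs: undirected edges usable in both directions).

`BHKMixedCounterexample.lean` (this cell) refutes the conjecture on a seven-vertex graph.  This file
isolates the MECHANISM on the smallest system found: the core `K4` = vertices `s = 0`, `t = 1`,
`x = 2`, `y = 3` with the opposite-arc pairs `s ⇄ x`, `t ⇄ y` and ONE undirected edge `{x, y}`, plus
two pendant arcs `s → s' = 4`, `t → t' = 5` (which only make `s ∈ V(C_s)`, `t ∈ V(C_t)` possible in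
the paper's convention).  With `f = 1[x ∈ V(C_s)]`, `g = 1[y ∉ V(C_t)]` and EVERY weight `7/8`:

  `P(Q) = 3007/16384`, `E[f;Q] = 4319/32768`, `E[g;Q] = 1695/32768`, `E[fg;Q] = 1183/32768`,
  `E[fg | Q] − E[f | Q]·E[g | Q] = −206143/36168196 < 0`.

(With the pendant arcs deterministic and the core at a uniform weight `p` the covariance is the closed
form `−p³(1−p)(p²+p−1)/(1+p+p²−2p³)²`, negative exactly for `p > (√5−1)/2`; the mechanism is the
competition of the two out-clusters for the single coin `{x, y}`: given `Q`, `s → x` open and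
`t → y` open force the edge closed.)  Everything is a finite sum over the `2^7` edge configurations
with integer weights in units of `8^{-7}`; the four masses are established by `decide +kernel`
(standard axioms only) and the inequality follows by `norm_num`.
-/

namespace Summit.Ventures.PercRepro2.BHKMixedCore

/-- An edge of a mixed graph: `arc = true` means the arc `u → v`, `arc = false` the undirected edge
`{u, v}`; the edge is open with probability `w / 8`. -/
structure MEdge where
  arc : Bool
  u : Nat
  v : Nat
  w : Nat

/-- The seven edges of the witness `K6` (vertices `0..5`; `s = 0`, `t = 1`, `x = 2`, `y = 3`,
`s' = 4`, `t' = 5`); every weight `7/8`. -/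
def edge : Nat → MEdge
  | 0 => ⟨true,  0, 2, 7⟩   -- s → x
  | 1 => ⟨true,  2, 0, 7⟩   -- x → s
  | 2 => ⟨true,  1, 3, 7⟩   -- t → y
  | 3 => ⟨true,  3, 1, 7⟩   -- y → t
  | 4 => ⟨false, 2, 3, 7⟩   -- {x, y}  (the one undirected edge)
  | 5 => ⟨true,  0, 4, 7⟩   -- s → s'
  | _ => ⟨true,  1, 5, 7⟩   -- t → t'

/-- The source `s = 0`. -/
def s : Nat := 0
/-- The target `t = 1`. -/
def t : Nat := 1

/-- Edge `i` is open in the configuration `c ∈ [0, 2^7)` iff bit `i` of `c` is set. -/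
def isOpen (c i : Nat) : Bool := c.testBit i

/-- Product Bernoulli weight of the configuration `c`, in units of `8^{-7}`:
`∏_i (w_i if open else 8 − w_i)`. -/
def wt (c : Nat) : Nat :=
  (List.range 7).foldl (fun acc i => acc * (if isOpen c i then (edge i).w else 8 - (edge i).w)) 1

/-- Vertex sets are bitmasks over `0..5`; `mem S x` is `x ∈ S`. -/
def mem (S x : Nat) : Bool := S.testBit x

/-- One expansion step of a vertex set along the open edges (arcs forward only, undirected edges
both ways). -/
def step (c S : Nat) : Nat :=
  (List.range 7).foldl (fun S i =>
    let e := edge i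
    if isOpen c i then
      let S₁ := if mem S e.u then S ||| (1 <<< e.v) else S
      if e.arc then S₁ else (if mem S₁ e.v then S₁ ||| (1 <<< e.u) else S₁)
    else S) S

/-- `n`-fold iteration of `step c`. -/
def iter (c : Nat) : Nat → Nat → Nat
  | 0, S => S
  | n + 1, S => iter c n (step c S)

/-- `R(v)`: the vertices reachable from `v` by open oriented paths (`v` included); six steps
suffice on six vertices. -/
def reach (c v : Nat) : Nat := iter c 6 (1 <<< v)

/-- `V(C_v)` in the paper's sense: the endpoints of the open edges lying on an open oriented path
from `v`, i.e. of the open edges usable from a vertex of `R(v)`. -/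
def VC (c v : Nat) : Nat :=
  let R := reach c v
  (List.range 7).foldl (fun S i =>
    let e := edge i
    if isOpen c i && (mem R e.u || (!e.arc && mem R e.v)) then S ||| (1 <<< e.u) ||| (1 <<< e.v)
    else S) 0

/-- The conditioning event `Q = {V(C_s) ∩ V(C_t) = ∅}`. -/
def Q (c : Nat) : Bool := (VC c s &&& VC c t) == 0
/-- `f = 1[x ∈ V(C_s)]` — increasing in `C_s`, constant in `C_t`. -/
def f (c : Nat) : Bool := mem (VC c s) 2
/-- `g = 1[y ∉ V(C_t)]` — constant in `C_s`, decreasing in `C_t`. -/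
def g (c : Nat) : Bool := !(mem (VC c t) 3)

/-- `8^7 · P(Q)`. -/
def massQ : Nat := (List.range 128).foldl (fun a c => if Q c then a + wt c else a) 0
/-- `8^7 · E[f; Q]`. -/
def massfQ : Nat := (List.range 128).foldl (fun a c => if Q c && f c then a + wt c else a) 0
/-- `8^7 · E[g; Q]`. -/
def massgQ : Nat := (List.range 128).foldl (fun a c => if Q c && g c then a + wt c else a) 0
/-- `8^7 · E[fg; Q]`. -/
def massfgQ : Nat := (List.range 128).foldl (fun a c => if Q c && f c && g c then a + wt c else a) 0

/-- Total mass `8^7` (sanity: the weights sum to one). -/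
theorem total_mass : (List.range 128).foldl (fun a c => a + wt c) 0 = 8 ^ 7 := by decide +kernel

/-- `8^7 · P(Q) = 3007 · 128`. -/
theorem massQ_eq : massQ = 384896 := by decide +kernel
/-- `8^7 · E[f; Q] = 4319 · 64`. -/
theorem massfQ_eq : massfQ = 276416 := by decide +kernel
/-- `8^7 · E[g; Q] = 1695 · 64`. -/
theorem massgQ_eq : massgQ = 108480 := by decide +kernel
/-- `8^7 · E[fg; Q] = 1183 · 64`. -/
theorem massfgQ_eq : massfgQ = 75712 := by decide +kernel

/-- `P(Q) = 3007/16384`. -/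
theorem probQ : (massQ : ℚ) / 8 ^ 7 = 3007 / 16384 := by rw [massQ_eq]; norm_num

/-- The conditional covariance on `Q` is `−206143/36168196 < 0`. -/
theorem conditional_covariance :
    (massfgQ : ℚ) / massQ - (massfQ / massQ) * (massgQ / massQ) = -206143 / 36168196 := by
  rw [massQ_eq, massfQ_eq, massgQ_eq, massfgQ_eq]; norm_num

/-- `E[fg | Q] < E[f | Q] · E[g | Q]` on the six-vertex mixed graph `K6` with every weight `7/8`:
the vdBHK mixed-graph conjecture fails already on six vertices, one undirected edge and two
opposite-arc pairs. -/
theorem vdBHK_mixed_conjecture_false_six :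
    (massfgQ : ℚ) / massQ < (massfQ / massQ) * (massgQ / massQ) := by
  rw [massQ_eq, massfQ_eq, massgQ_eq, massfgQ_eq]; norm_num

end Summit.Ventures.PercRepro2.BHKMixedCore
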